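import Literature.RingTheory.Length.ColengthFinrank
import HarnessLib

/-!
# Truncated colengths: stabilisation, the fat-point criterion, and its Nakayama lift

`Literature/RingTheory/Length/TruncatedColengthCriterion.lean`. Let `A` be a commutative algebra over
a field `κ`, `I` and `m` ideals of `A` (think: `I` = an ideal of equations, `m` = the ideal of a
point), and consider the TRUNCATIONS `I + m^j`, `j = 0, 1, 2, …` and their colengths
`c_j = dim_κ A/(I + m^(j+1))` (the Hilbert–Samuel function of `A/I` at `m`). All statements are
PROVED; there are no definitions and no named facts. [folklore; Atiyah–Macdonald, Prop. 2.6
(Nakayama) and the proof of Prop. 8.6 (`m^n = m^(n+1) ⟹ m^n = 0`)]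

* `pow_succ_le_sup_of_pow_le_sup`, `pow_le_sup_pow_succ_of_le`, `sup_pow_eq_of_pow_le_sup` —
  **stabilisation**: once `m^i ≤ I + m^(i+1)`, then `m^j ≤ I + m^(j+1)` and `I + m^j = I + m^i` for
  every `j ≥ i` (pure ideal arithmetic: multiply by `m`).
* `pow_le_sup_pow_succ_of_finrank_eq` — **the stabilisation criterion**: if two consecutive
  truncations have the same (finite) colength, `dim A/(I + m^(M+1)) = dim A/(I + m^M)`, then
  `m^M ≤ I + m^(M+1)` (hence the colengths are constant from `M` on).
* `pow_le_sup_pow_succ_of_finrank_le` — **the fat-point criterion**: if ONE truncation is small,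
  `dim_κ A/(I + m^(n+1)) ≤ n`, then `m^n ≤ I + m^(n+1)` (the chain `A ⊋ I+m ⊋ I+m² ⊋ …` can drop at
  most `n` times).
* `pow_le_of_pow_le_sup_of_le_jacobson`, `pow_le_of_finrank_le_of_le_jacobson`,
  `sup_pow_succ_eq_of_finrank_le_of_le_jacobson`, `finite_quotient_of_finrank_le_of_le_jacobson`,
  `finrank_quotient_eq_of_finrank_le_of_le_jacobson` — **Nakayama lift**: if moreover `m` lies in the
  Jacobson radical (e.g. `A` local, or `m` nilpotent) and `m^n` is finitely generated, then `m^n ≤ I`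
  itself, so `A/I = A/(I + m^(n+1))` is a finite `κ`-algebra ("fat point") of that colength.

Use (Hodge-locus census, cell `pub-hlocus`, COMPONENTS.md 'CRITERION' and 'UNIFORMITY IN λ'): with
`A` = the local ring of the slice `(Λ', 0)` (or its truncation `κ[t]/(t)^(N+1)`, where `m = (t)` is
nilpotent), `I` = the ideal of restricted period equations, the computed Hilbert–Samuel samples
`HS(k) = dim A/(I + m^(k+1))`: `HS(M) = HS(M-1)` or `HS(N) ≤ N` give `m^M ≤ I` resp. `m^N ≤ I`, i.e.
the germ `V_δ ∩ Λ'` is a fat point of length `HS(M)`; and since `HS(N)` is a corank of a matrix affine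
in the parameter `λ` (`Literature.LinearAlgebra.Matrix.setOf_lt_corank_map_eval_finite`, file
`Literature/LinearAlgebra/Matrix/PolynomialMatrixRankLoci.lean`), the inequality `HS(N) ≤ N` certified
at one `λ₀` holds at all but finitely many `λ`.

## References

* [AtiyahMacdonald1969] M. F. Atiyah, I. G. Macdonald, Introduction to Commutative Algebra,
  Addison-Wesley 1969, Prop. 2.6, Cor. 2.7, Prop. 8.6.
* [HunekeSwanson2006] C. Huneke, I. Swanson, Integral Closure of Ideals, Rings, and Modules, CUP 2006,
  §14.1 (colength bookkeeping, via `ColengthFinrank`).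
-/

noncomputable section

open Module

namespace Literature.RingTheory.Length

variable {A : Type*} [CommRing A]

/-- **Propagation.** `m^i ≤ I + m^(i+1)` implies `m^(i+1) ≤ I + m^(i+2)` (multiply by `m`).
[folklore] -/
theorem pow_succ_le_sup_of_pow_le_sup {I m : Ideal A} {i : ℕ} (h : m ^ i ≤ I ⊔ m ^ (i + 1)) :
    m ^ (i + 1) ≤ I ⊔ m ^ (i + 2) := by
  calc m ^ (i + 1) = m * m ^ i := by rw [pow_succ']
    _ ≤ m * (I ⊔ m ^ (i + 1)) := Ideal.mul_mono_right h
    _ = m * I ⊔ m * m ^ (i + 1) := Ideal.mul_sup _ _ _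
    _ ≤ I ⊔ m ^ (i + 2) := sup_le_sup Ideal.mul_le_left (by rw [← pow_succ'])

/-- **Stabilisation, I.** `m^i ≤ I + m^(i+1)` implies `m^j ≤ I + m^(j+1)` for all `j ≥ i`.
[folklore] -/
theorem pow_le_sup_pow_succ_of_le {I m : Ideal A} {i j : ℕ} (h : m ^ i ≤ I ⊔ m ^ (i + 1))
    (hij : i ≤ j) : m ^ j ≤ I ⊔ m ^ (j + 1) := by
  induction j, hij using Nat.le_induction with
  | base => exact h
  | succ k _ ih => exact pow_succ_le_sup_of_pow_le_sup ih

/-- **Stabilisation, II.** `m^i ≤ I + m^(i+1)` implies `I + m^j = I + m^i` for all `j ≥ i`: the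
truncations are constant from `i` on. [folklore] -/
theorem sup_pow_eq_of_pow_le_sup {I m : Ideal A} {i j : ℕ} (h : m ^ i ≤ I ⊔ m ^ (i + 1))
    (hij : i ≤ j) : I ⊔ m ^ j = I ⊔ m ^ i := by
  induction j, hij using Nat.le_induction with
  | base => rfl
  | succ k hk ih =>
    apply le_antisymm
    · exact sup_le_sup_left (Ideal.pow_le_pow_right (by omega)) _
    · rw [← ih]
      exact sup_le le_sup_left (pow_le_sup_pow_succ_of_le h hk)

/-- **Nakayama lift.** If `m` lies in the Jacobson radical of `A` (e.g. `A` local with maximal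
ideal `m`, or `m` nilpotent) and `m^i` is finitely generated, then `m^i ≤ I + m^(i+1)` already gives
`m^i ≤ I` (Atiyah–Macdonald, Cor. 2.7). [folklore] -/
theorem pow_le_of_pow_le_sup_of_le_jacobson {I m : Ideal A} {i : ℕ}
    (h : m ^ i ≤ I ⊔ m ^ (i + 1)) (hm : m ≤ Ideal.jacobson ⊥) (hfg : (m ^ i).FG) :
    m ^ i ≤ I := by
  refine Submodule.le_of_le_smul_of_le_jacobson_bot hfg hm ?_
  rw [Ideal.smul_eq_mul, ← pow_succ']
  exact h

variable {κ : Type*} [Field κ] [Algebra κ A]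

/-- **Stabilisation criterion (`HS(M) = HS(M-1)`).** If the truncations `I + m^(M+1) ≤ I + m^M`
have finite and EQUAL colengths over `κ`, then `m^M ≤ I + m^(M+1)`, and therefore
(`sup_pow_eq_of_pow_le_sup`) all further truncations coincide with `I + m^M`. [folklore] -/
theorem pow_le_sup_pow_succ_of_finrank_eq {I m : Ideal A} {M : ℕ}
    [Module.Finite κ (A ⧸ (I ⊔ m ^ (M + 1)))]
    (h : finrank κ (A ⧸ (I ⊔ m ^ (M + 1))) = finrank κ (A ⧸ (I ⊔ m ^ M))) :
    m ^ M ≤ I ⊔ m ^ (M + 1) := by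
  have hle : I ⊔ m ^ (M + 1) ≤ I ⊔ m ^ M :=
    sup_le_sup_left (Ideal.pow_le_pow_right (Nat.le_succ M)) _
  rcases hle.eq_or_lt with heq | hlt
  · calc m ^ M ≤ I ⊔ m ^ M := le_sup_right
      _ = I ⊔ m ^ (M + 1) := heq.symm
  · have := finrank_quotient_lt_of_lt (κ := κ) hlt
    omega

/-- **Fat-point criterion (`HS(n) ≤ n`).** If the truncation `A/(I + m^(n+1))` is finite over `κ`
of dimension `≤ n`, then `m^n ≤ I + m^(n+1)`: in the chain `A = I+m⁰ ⊇ I+m ⊇ … ⊇ I+m^(n+1)` each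
strict step costs one dimension, so the chain has stabilised by step `n` (cf. Atiyah–Macdonald,
proof of Prop. 8.6). [folklore] -/
theorem pow_le_sup_pow_succ_of_finrank_le {I m : Ideal A} {n : ℕ}
    [Module.Finite κ (A ⧸ (I ⊔ m ^ (n + 1)))]
    (h : finrank κ (A ⧸ (I ⊔ m ^ (n + 1))) ≤ n) :
    m ^ n ≤ I ⊔ m ^ (n + 1) := by
  by_contra hnot
  -- no earlier step can have stabilised either
  have hstep : ∀ i ≤ n, ¬ m ^ i ≤ I ⊔ m ^ (i + 1) := fun i hi hle =>
    hnot (pow_le_sup_pow_succ_of_le hle hi)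
  have hfin : ∀ i ≤ n + 1, Module.Finite κ (A ⧸ (I ⊔ m ^ i)) := fun i hi =>
    finite_quotient_of_le (κ := κ) (sup_le_sup_left (Ideal.pow_le_pow_right hi) I)
  -- hence every step is strict
  have hlt : ∀ i ≤ n, I ⊔ m ^ (i + 1) < I ⊔ m ^ i := by
    intro i hi
    refine lt_of_le_of_ne (sup_le_sup_left (Ideal.pow_le_pow_right (Nat.le_succ i)) _) ?_
    intro heq
    apply hstep i hi
    calc m ^ i ≤ I ⊔ m ^ i := le_sup_right
      _ = I ⊔ m ^ (i + 1) := heq.symm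
  -- and the colength of the `i`-th truncation is at least `i`
  have hcount : ∀ i ≤ n + 1, i ≤ finrank κ (A ⧸ (I ⊔ m ^ i)) := by
    intro i
    induction i with
    | zero => intro; exact Nat.zero_le _
    | succ i ih =>
      intro hi
      haveI := hfin (i + 1) hi
      have h1 := finrank_quotient_lt_of_lt (κ := κ) (hlt i (by omega))
      have h2 := ih (by omega)
      omega
  have := hcount (n + 1) le_rfl
  omega

/-- **Fat-point criterion, local form.** Under the hypothesis of
`pow_le_sup_pow_succ_of_finrank_le`, if `m` lies in the Jacobson radical and `m^n` is finitely
generated (e.g. `A` Noetherian local with maximal ideal `m`), then `m^n ≤ I`. [folklore] -/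
theorem pow_le_of_finrank_le_of_le_jacobson {I m : Ideal A} {n : ℕ}
    [Module.Finite κ (A ⧸ (I ⊔ m ^ (n + 1)))]
    (h : finrank κ (A ⧸ (I ⊔ m ^ (n + 1))) ≤ n)
    (hm : m ≤ Ideal.jacobson ⊥) (hfg : (m ^ n).FG) : m ^ n ≤ I :=
  pow_le_of_pow_le_sup_of_le_jacobson (pow_le_sup_pow_succ_of_finrank_le (κ := κ) h) hm hfg

/-- Under the same hypotheses the truncation was no truncation: `I + m^(n+1) = I`. [folklore] -/
theorem sup_pow_succ_eq_of_finrank_le_of_le_jacobson {I m : Ideal A} {n : ℕ}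
    [Module.Finite κ (A ⧸ (I ⊔ m ^ (n + 1)))]
    (h : finrank κ (A ⧸ (I ⊔ m ^ (n + 1))) ≤ n)
    (hm : m ≤ Ideal.jacobson ⊥) (hfg : (m ^ n).FG) : I ⊔ m ^ (n + 1) = I := by
  refine le_antisymm (sup_le le_rfl ?_) le_sup_left
  exact (Ideal.pow_le_pow_right (Nat.le_succ n)).trans
    (pow_le_of_finrank_le_of_le_jacobson (κ := κ) h hm hfg)

/-- … hence `A/I` is itself a finite `κ`-algebra (a "fat point"). [folklore] -/
theorem finite_quotient_of_finrank_le_of_le_jacobson {I m : Ideal A} {n : ℕ}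
    [Module.Finite κ (A ⧸ (I ⊔ m ^ (n + 1)))]
    (h : finrank κ (A ⧸ (I ⊔ m ^ (n + 1))) ≤ n)
    (hm : m ≤ Ideal.jacobson ⊥) (hfg : (m ^ n).FG) : Module.Finite κ (A ⧸ I) :=
  finite_quotient_of_le (κ := κ)
    (sup_pow_succ_eq_of_finrank_le_of_le_jacobson (κ := κ) h hm hfg).le

/-- … of the same length as the truncation: `dim_κ A/I = dim_κ A/(I + m^(n+1))`. [folklore] -/
theorem finrank_quotient_eq_of_finrank_le_of_le_jacobson {I m : Ideal A} {n : ℕ}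
    [Module.Finite κ (A ⧸ (I ⊔ m ^ (n + 1)))]
    (h : finrank κ (A ⧸ (I ⊔ m ^ (n + 1))) ≤ n)
    (hm : m ≤ Ideal.jacobson ⊥) (hfg : (m ^ n).FG) :
    finrank κ (A ⧸ I) = finrank κ (A ⧸ (I ⊔ m ^ (n + 1))) := by
  rw [sup_pow_succ_eq_of_finrank_le_of_le_jacobson (κ := κ) h hm hfg]

end Literature.RingTheory.Length
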